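import Mathlib
import HarnessLib
import Summits.MatrixMultiplication.MatrixMultiplication.Theorems.OutsiderSandwichCouplingSubrank
import Summits.MatrixMultiplication.MatrixMultiplication.Theorems.OutsiderSandwichEdgeRigidity

/-!
# OutsiderSandwich — block descent: the minimal counterexample lives on one coupled block of `cw₂ ⊗ cw₂`

Route `OutsiderSandwich` (decomp-mm, lens 4: minimal counterexample / extremal reduction, generation 17;
kernel 3 of the coupling line after `OutsiderSandwichCoupling`, `OutsiderSandwichCouplingSubrank`).
Generation 16 localised a minimal counterexample to `ω = 2` on the coupling tensor `C = C₁ ⊠ C₂ ⊠ C₃`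
(`64³`).  Here it is pushed onto the single **coupled block** `C₁ = coupling₁` (`4 × 4 × 4`, eight ones,
`C₁ = Σ_{a,b} x_{ab} (y_{a0} z_{0b} + y_{0b} z_{a0})`; x-slice space `{A ⊕ Aᵀ} ≅ {A ⊕ adj A}`, i.e.
`C₁ ≅ ⟨2,2,2⟩ − (x₁₁+x₂₂) ⊗ I''`; free, tight, uniform marginals; flattening ranks `(4,4,4)`; generic
slice ranks `(4,3,3)`; border rank `≥ 6`; no known universal spectral point separates it from `⟨2,2,2⟩`).

* §1 pieces: `BlockTangency` (attacked), `BlockMergeOptimal` (residual), the ω-free leaf `BlockIsMM`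
  (`⟨2,2,2⟩ ≲ C_k`), the in-print floor `BlockSubrankFull` / `BlockDiagonal` (`Q̃(C_k) = 4`, Strassen
  1991), the provable benchmark `CouplingBenchmark` (`4F⟨2,2,2⟩² ≤ F(C)`: the outer block support of `C`
  is exactly `supp⟨2,2,2⟩` with blocks `≅ ⟨4,4,4⟩`, so Salem–Spencer zeroing packs `4^{N−o(N)}` disjoint
  `⟨4^N,4^N,4^N⟩` into `C^{⊠N}`), and the ω-free dischargers `BlockRankLeFour` (`R̃(C_k) ≤ 4`, an
  asymptotic-rank-conjecture instance) and `BlockBelowMM` (`C₁ ≲ ⟨2,2,2⟩`) of the residual;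
* §2 NEC: `S ⟹ BlockTangency` (vacuous), `S ⟹ BlockMergeOptimal` (`ζ₁`), `BlockSubrankFull → S → BlockIsMM`;
* §3 **`summit_iff_block : S ⟺ BlockTangency ∧ BlockMergeOptimal`** (hypothesis-free);
* §4 edges `BlockTangency ⟹ CouplingTangency`, `CouplingMergeOptimal ⟹ BlockMergeOptimal` (residual
  weaker again: `LaserMergeOptimal ⟹ CouplingMergeOptimal ⟹ BlockMergeOptimal`), `BlockIsMM ⟹ CouplingIsMM`,
  `BlockDiagonal ⟹ BlockSubrankFull ⟹ CouplingSubrankFull`, `BlockSubrankFull → BlockTangency → BlockIsMM`,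
  `summit_iff_blockIsMM : BlockSubrankFull → (S ⟺ BlockIsMM ∧ CouplingMergeOptimal)`;
* §5 the door **`CouplingBenchmark → BlockRankLeFour → S`**: if `ω > 2`, one of the explicit `4 × 4 × 4`
  free tight tensors `C_k` violates Strassen's asymptotic rank conjecture; `BlockRankLeFour`,
  `BlockBelowMM ⟹` the residuals.

References: Coppersmith–Winograd, J. Symbolic Comput. 9 (1990), §§6–7 [CoppersmithWinograd1990];
Bürgisser–Clausen–Shokrollahi (1997) §15.7–15.8 [BurgisserClausenShokrollahi1997]; Strassen, Crelle 384
(1988) Thm. 3.8 and 413 (1991) [Strassen1988]; Christandl–Vrana–Zuiddam, JAMS 36 (2023) Prop. 1.6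
[ChristandlVranaZuiddam2023]; Conner–Gesmundo–Landsberg–Ventura, comput. complexity 31 (2022) =
arXiv:1909.04785 (tensors whose minimal asymptotic rank would give `ω = 2`).
-/

open scoped BigOperators Topology
open Filter
open Literature.Computability.AlgebraicComplexity
open Summit.MatrixMultiplication.MatrixMultiplication.Theorems.OutsiderSandwichLaserFloor
open Summit.MatrixMultiplication.MatrixMultiplication.Theorems.OutsiderSandwichLaserFloorCut
open Summit.MatrixMultiplication.MatrixMultiplication.Theorems.OutsiderSandwichLaserFloorTop
open Summit.MatrixMultiplication.MatrixMultiplication.Theorems.OutsiderSandwichContactFace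
open Summit.MatrixMultiplication.MatrixMultiplication.Theorems.OutsiderSandwichCoupling
open Summit.MatrixMultiplication.MatrixMultiplication.Theorems.OutsiderSandwichCouplingSubrank
open Summit.MatrixMultiplication.MatrixMultiplication.Theorems.OutsiderSandwichEdgeRigidity (four_le_map_matMulTensor_two)

namespace Summit.MatrixMultiplication.MatrixMultiplication.Theorems.OutsiderSandwichBlock

variable {F : SpectralMap ℂ}

/-! ## 0. Spectral facts about `⟨2,2,2⟩` -/
/-- `0 < F⟨2,2,2⟩`. -/
theorem map_matMulTensor_pos (hF : IsUniversalSpectralPoint ℂ F) : 0 < F (matMulTensor ℂ 2 2 2) :=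
  lt_of_lt_of_le one_pos (one_le_map_matMulTensor hF (by norm_num))

/-- `τ_F ≤ 2 ⟹ F⟨2,2,2⟩ ≤ 4`. -/
theorem map_matMulTensor_le_four_of_matExp_le_two (hF : IsUniversalSpectralPoint ℂ F)
    (hτ : Real.logb 2 (F (matMulTensor ℂ 2 2 2)) ≤ 2) : F (matMulTensor ℂ 2 2 2) ≤ 4 := by
  have h := (Real.logb_le_iff_le_rpow one_lt_two (map_matMulTensor_pos hF)).1 hτ
  rw [Real.rpow_two] at h
  linarith

/-- `F⟨2,2,2⟩ ≤ 4 ⟹ τ_F ≤ 2`. -/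
theorem matExp_le_two_of_map_le_four (hF : IsUniversalSpectralPoint ℂ F)
    (h4 : F (matMulTensor ℂ 2 2 2) ≤ 4) : Real.logb 2 (F (matMulTensor ℂ 2 2 2)) ≤ 2 := by
  calc Real.logb 2 (F (matMulTensor ℂ 2 2 2)) ≤ Real.logb 2 4 :=
        Real.logb_le_logb_of_le one_lt_two (map_matMulTensor_pos hF) h4
    _ = 2 := by
        rw [show (4 : ℝ) = (2 : ℝ) ^ (2 : ℝ) by rw [Real.rpow_two]; norm_num,
          Real.logb_rpow two_pos (by norm_num)]

/-- An ω-attaining universal point with `F⟨2,2,2⟩ ≤ 4` forces the summit. -/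
theorem summit_of_top_le_four (hF : IsUniversalSpectralPoint ℂ F)
    (hτ : Real.logb 2 (F (matMulTensor ℂ 2 2 2)) = omega ℂ) (h4 : F (matMulTensor ℂ 2 2 2) ≤ 4) :
    _root_.MatrixMultiplication := by
  have hle := matExp_le_two_of_map_le_four hF h4
  rw [hτ] at hle
  exact (_root_.MatrixMultiplication_iff).2 (le_antisymm hle (omega_two_le (K := ℂ)))

/-! ## 1. The pieces of the block cut -/
/-- **BlockTangency** (attacked piece `A″`): every universal spectral point with matrix exponent
`τ_F > 2` is STRICTLY super-MM on each coupled block: `F⟨2,2,2⟩ < F(C_k)`, `k = 1,2,3`. -/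
def BlockTangency : Prop :=
  ∀ F : SpectralMap ℂ, IsUniversalSpectralPoint ℂ F → 2 < Real.logb 2 (F (matMulTensor ℂ 2 2 2)) →
    F (matMulTensor ℂ 2 2 2) < F coupling₁ ∧ F (matMulTensor ℂ 2 2 2) < F coupling₂ ∧
      F (matMulTensor ℂ 2 2 2) < F coupling₃

/-- **BlockMergeOptimal** (residual `R″`): some ω-attaining universal spectral point is NOT strictly
super-MM on some coupled block. -/
def BlockMergeOptimal : Prop :=
  ∃ F : SpectralMap ℂ, IsUniversalSpectralPoint ℂ F ∧
    Real.logb 2 (F (matMulTensor ℂ 2 2 2)) = omega ℂ ∧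
    (F coupling₁ ≤ F (matMulTensor ℂ 2 2 2) ∨ F coupling₂ ≤ F (matMulTensor ℂ 2 2 2) ∨
      F coupling₃ ≤ F (matMulTensor ℂ 2 2 2))

/-- **BlockIsMM** (ω-free leaf): `F⟨2,2,2⟩ ≤ F(C_k)` at every universal spectral point, `k = 1,2,3`, i.e.
(Strassen's spectral theorem) `⟨2,2,2⟩ ≲ C_k`; same format, support size, flattening ranks and quantum
values on both sides; no finite degeneration (`⟨2,2,2⟩ ≰ C_k`, Theorems `OutsiderSandwichCoupledBlock`). -/
def BlockIsMM : Prop :=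
  ∀ F : SpectralMap ℂ, IsUniversalSpectralPoint ℂ F →
    F (matMulTensor ℂ 2 2 2) ≤ F coupling₁ ∧ F (matMulTensor ℂ 2 2 2) ≤ F coupling₂ ∧
      F (matMulTensor ℂ 2 2 2) ≤ F coupling₃

/-- **BlockSubrankFull** (spectral shadow of `Q̃(C_k) = 4`; Strassen 1991 for the tight free support of
`C_k` with uniform marginals): `4 ≤ F(C_k)` at every universal spectral point. -/
def BlockSubrankFull : Prop :=
  ∀ F : SpectralMap ℂ, IsUniversalSpectralPoint ℂ F →
    (4 : ℝ) ≤ F coupling₁ ∧ (4 : ℝ) ≤ F coupling₂ ∧ (4 : ℝ) ≤ F coupling₃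

/-- **BlockDiagonal** (operational `Q̃(C_k) = 4`, ω-free): cofinally in `N`, each `C_k^{⊠N}` restricts to a
diagonal of size `r ≥ 4^N 2^{-εN}` — Strassen, Crelle 413 (1991) / CVZ arXiv:1709.07851 Thm. 4.4 for the
tight support of `C_k` (`α(x_{ab}) = −a−3b`, `β(y_{a0}) = a`, `β(y_{0b}) = 3b`, `γ(z_{0b}) = 3b`,
`γ(z_{a0}) = a`) with uniform marginals. -/
def BlockDiagonal : Prop :=
  ∀ ε : ℝ, 0 < ε → ∀ N₀ : ℕ, ∃ N : ℕ, N₀ ≤ N ∧ ∃ r : ℕ,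
    (TensorRestrictsTo (kroneckerPow coupling₁ N) (unitTensor ℂ r) ∧
      TensorRestrictsTo (kroneckerPow coupling₂ N) (unitTensor ℂ r) ∧
      TensorRestrictsTo (kroneckerPow coupling₃ N) (unitTensor ℂ r)) ∧
    (4 : ℝ) ^ N ≤ (r : ℝ) * (2 : ℝ) ^ (ε * N)

/-- **CouplingBenchmark** (ω-free, provable): `4 F⟨2,2,2⟩² ≤ F(C)`.  The outer block support of `C`
(blocks = the halves `y_{·0} | y_{0·}` etc.) is exactly `supp ⟨2,2,2⟩`, each block a copy of `⟨4,4,4⟩`;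
zeroing `C^{⊠N}` along a Salem–Spencer induced matching of `supp ⟨2^N,2^N,2^N⟩` (size `4^{N−o(N)}`,
`exists_tensorMonRestrictsTo_matMulTensor_unitTensor`) leaves that many disjoint `⟨4^N,4^N,4^N⟩`.
A HYPOTHESIS below; to be proved separately. -/
def CouplingBenchmark : Prop :=
  ∀ F : SpectralMap ℂ, IsUniversalSpectralPoint ℂ F →
    4 * F (matMulTensor ℂ 2 2 2) ^ 2 ≤ F couplingTensor

/-- **BlockRankLeFour** (ω-free; the instance of Strassen's asymptotic rank conjecture for the three
coupled blocks): `R̃(C_k) ≤ 4` (`= 4`, the flattening rank).  NOT a decomposition piece: with the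
benchmark it implies the summit outright (`summit_of_blockRankLeFour`, §5). -/
def BlockRankLeFour : Prop :=
  asymptoticRank coupling₁ ≤ 4 ∧ asymptoticRank coupling₂ ≤ 4 ∧ asymptoticRank coupling₃ ≤ 4

/-- **BlockBelowMM** (ω-free): `C₁ ≲ ⟨2,2,2⟩`, i.e. `F(C₁) ≤ F⟨2,2,2⟩` at every universal point. -/
def BlockBelowMM : Prop :=
  ∀ F : SpectralMap ℂ, IsUniversalSpectralPoint ℂ F → F coupling₁ ≤ F (matMulTensor ℂ 2 2 2)

/-! ## 2. The pieces are implied by the summit -/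
/-- `S ⟹ BlockTangency` (vacuously: under `ω = 2` no universal point has `τ_F > 2`). -/
theorem blockTangency_of_summit (hS : _root_.MatrixMultiplication) : BlockTangency := by
  intro F hF hτ
  have hω : omega ℂ = 2 := (_root_.MatrixMultiplication_iff).1 hS
  have h := matExp_le_omega hF
  linarith

/-- `S ⟹ BlockMergeOptimal`, witnessed by `ζ₁`: `ζ₁⟨2,2,2⟩ = 4 = 2^ω` and `ζ₁(C₁) ≤ 4`.
[cite: Strassen1988, Thm. 3.8] -/
theorem blockMergeOptimal_of_summit (hS : _root_.MatrixMultiplication) : BlockMergeOptimal := by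
  have hω : omega ℂ = 2 := (_root_.MatrixMultiplication_iff).1 hS
  refine ⟨gaugePoint₁ ℂ, gaugePoint₁_isUniversalSpectralPoint ℂ, ?_, Or.inl ?_⟩
  · rw [gaugePoint₁_matMulTensor_two, hω, show (4 : ℝ) = (2 : ℝ) ^ (2 : ℝ) by rw [Real.rpow_two]; norm_num,
      Real.logb_rpow (by norm_num) (by norm_num)]
  · rw [gaugePoint₁_matMulTensor_two]
    exact gaugePoint₁_le_four coupling₁

/-- `S ⟹ BlockIsMM` given full block subrank: `F⟨2,2,2⟩ ≤ 4 ≤ F(C_k)`.  So the ω-free leaf is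
NECESSARY for `ω = 2` modulo Strassen's tight-subrank theorem for the `4 × 4 × 4` block. -/
theorem blockIsMM_of_summit (hQ : BlockSubrankFull) (hS : _root_.MatrixMultiplication) : BlockIsMM := by
  intro F hF
  have h4 := map_matMulTensor_le_four_of_summit hS hF
  obtain ⟨h₁, h₂, h₃⟩ := hQ F hF
  exact ⟨h4.trans h₁, h4.trans h₂, h4.trans h₃⟩

/-- `S ⟹ CouplingBenchmark` given full subrank of `C`: `4 F⟨2,2,2⟩² ≤ 4 · 16 = 64 ≤ F(C)`. -/
theorem couplingBenchmark_of_summit (hQ : CouplingSubrankFull) (hS : _root_.MatrixMultiplication) :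
    CouplingBenchmark := by
  intro F hF
  have h4 := map_matMulTensor_le_four_of_summit hS hF
  have h0 : 0 ≤ F (matMulTensor ℂ 2 2 2) := hF.nonneg _
  calc 4 * F (matMulTensor ℂ 2 2 2) ^ 2 ≤ 4 * (4 : ℝ) ^ 2 := by gcongr
    _ = 64 := by norm_num
    _ ≤ F couplingTensor := hQ F hF

/-! ## 3. The block cut is exact -/

/-- **Glue.** `BlockTangency → BlockMergeOptimal → S`: the residual supplies an ω-attaining point that is
not strictly super-MM on some block; tangency forbids `τ > 2` there, so `ω = τ ≤ 2`. -/
theorem summit_of_block (hA : BlockTangency) (hR : BlockMergeOptimal) : _root_.MatrixMultiplication := by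
  obtain ⟨F, hF, hτ, hC⟩ := hR
  have hle : Real.logb 2 (F (matMulTensor ℂ 2 2 2)) ≤ 2 := by
    by_contra h
    push Not at h
    obtain ⟨h₁, h₂, h₃⟩ := hA F hF h
    rcases hC with hc | hc | hc
    · exact absurd hc (not_le.2 h₁)
    · exact absurd hc (not_le.2 h₂)
    · exact absurd hc (not_le.2 h₃)
  rw [hτ] at hle
  exact (_root_.MatrixMultiplication_iff).2 (le_antisymm hle (omega_two_le (K := ℂ)))

/-- **The block cut is exact** (hypothesis-free): `S ⟺ BlockTangency ∧ BlockMergeOptimal`. -/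
theorem summit_iff_block : _root_.MatrixMultiplication ↔ BlockTangency ∧ BlockMergeOptimal :=
  ⟨fun h => ⟨blockTangency_of_summit h, blockMergeOptimal_of_summit h⟩, fun h => summit_of_block h.1 h.2⟩

/-! ## 4. Descent edges -/

/-- **`BlockIsMM ⟹ CouplingIsMM`**: multiply the three block comparisons, `F⟨2,2,2⟩³ ≤ F(C₁)F(C₂)F(C₃) = F(C)`. -/
theorem couplingIsMM_of_blockIsMM (h : BlockIsMM) : CouplingIsMM := by
  intro F hF
  obtain ⟨h₁, h₂, h₃⟩ := h F hF
  have h0 : 0 ≤ F (matMulTensor ℂ 2 2 2) := hF.nonneg _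
  rw [map_couplingTensor hF]
  calc F (matMulTensor ℂ 2 2 2) ^ 3
      = F (matMulTensor ℂ 2 2 2) * F (matMulTensor ℂ 2 2 2) * F (matMulTensor ℂ 2 2 2) := by ring
    _ ≤ F coupling₁ * F coupling₂ * F coupling₃ :=
        mul_le_mul (mul_le_mul h₁ h₂ h0 (h0.trans h₁)) h₃ h0 (mul_nonneg (h0.trans h₁) (h0.trans h₂))

/-- **`BlockTangency ⟹ CouplingTangency`**: at `τ_F > 2`, `4 F² < F³ < F(C₁)F(C₂)F(C₃) = F(C)`. -/
theorem couplingTangency_of_blockTangency (h : BlockTangency) : CouplingTangency := by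
  intro F hF hτ
  obtain ⟨h₁, h₂, h₃⟩ := h F hF hτ
  have h4 := four_lt_map_matMulTensor hF hτ
  have h0 : 0 < F (matMulTensor ℂ 2 2 2) := map_matMulTensor_pos hF
  rw [map_couplingTensor hF]
  calc 4 * F (matMulTensor ℂ 2 2 2) ^ 2
      < F (matMulTensor ℂ 2 2 2) * F (matMulTensor ℂ 2 2 2) ^ 2 := mul_lt_mul_of_pos_right h4 (by positivity)
    _ = F (matMulTensor ℂ 2 2 2) * F (matMulTensor ℂ 2 2 2) * F (matMulTensor ℂ 2 2 2) := by ring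
    _ < F coupling₁ * F coupling₂ * F coupling₃ := by
        have hp₁ : 0 < F coupling₁ := h0.trans h₁
        have hp₂ : 0 < F coupling₂ := h0.trans h₂
        calc F (matMulTensor ℂ 2 2 2) * F (matMulTensor ℂ 2 2 2) * F (matMulTensor ℂ 2 2 2)
            < F coupling₁ * F (matMulTensor ℂ 2 2 2) * F (matMulTensor ℂ 2 2 2) := by gcongr
          _ < F coupling₁ * F coupling₂ * F (matMulTensor ℂ 2 2 2) := by gcongr
          _ < F coupling₁ * F coupling₂ * F coupling₃ := by gcongr

/-- **`CouplingMergeOptimal ⟹ BlockMergeOptimal`** (the residual got weaker): at the ω-attaining point of the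
coupling residual either `F⟨2,2,2⟩ ≤ 4` (then `ω = 2` and `ζ₁` witnesses the block residual) or
`F⟨2,2,2⟩ > 4`, and then `F(C) ≤ 4F² < F³` forbids all three blocks to be strictly super-MM. -/
theorem blockMergeOptimal_of_couplingMergeOptimal (h : CouplingMergeOptimal) : BlockMergeOptimal := by
  obtain ⟨F, hF, hτ, hC⟩ := h
  by_cases h4 : F (matMulTensor ℂ 2 2 2) ≤ 4
  · exact blockMergeOptimal_of_summit (summit_of_top_le_four hF hτ h4)
  · push Not at h4
    refine ⟨F, hF, hτ, ?_⟩
    by_contra hne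
    push Not at hne
    obtain ⟨h₁, h₂, h₃⟩ := hne
    have h0 : 0 < F (matMulTensor ℂ 2 2 2) := map_matMulTensor_pos hF
    have hlt : 4 * F (matMulTensor ℂ 2 2 2) ^ 2 < F couplingTensor := by
      rw [map_couplingTensor hF]
      have hp₁ : 0 < F coupling₁ := h0.trans h₁
      have hp₂ : 0 < F coupling₂ := h0.trans h₂
      calc 4 * F (matMulTensor ℂ 2 2 2) ^ 2
          < F (matMulTensor ℂ 2 2 2) * F (matMulTensor ℂ 2 2 2) ^ 2 :=
            mul_lt_mul_of_pos_right h4 (by positivity)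
        _ = F (matMulTensor ℂ 2 2 2) * F (matMulTensor ℂ 2 2 2) * F (matMulTensor ℂ 2 2 2) := by ring
        _ < F coupling₁ * F (matMulTensor ℂ 2 2 2) * F (matMulTensor ℂ 2 2 2) := by gcongr
        _ < F coupling₁ * F coupling₂ * F (matMulTensor ℂ 2 2 2) := by gcongr
        _ < F coupling₁ * F coupling₂ * F coupling₃ := by gcongr
    exact absurd hC (not_le.2 hlt)

/-- **`BlockSubrankFull ⟹ CouplingSubrankFull`**: `64 = 4·4·4 ≤ F(C₁)F(C₂)F(C₃) = F(C)`. -/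
theorem couplingSubrankFull_of_blockSubrankFull (hQ : BlockSubrankFull) : CouplingSubrankFull := by
  intro F hF
  obtain ⟨h₁, h₂, h₃⟩ := hQ F hF
  rw [map_couplingTensor hF]
  calc (64 : ℝ) = 4 * 4 * 4 := by norm_num
    _ ≤ F coupling₁ * F coupling₂ * F coupling₃ :=
        mul_le_mul (mul_le_mul h₁ h₂ (by norm_num) ((by norm_num : (0:ℝ) ≤ 4).trans h₁)) h₃
          (by norm_num) (mul_nonneg ((by norm_num : (0:ℝ) ≤ 4).trans h₁) ((by norm_num : (0:ℝ) ≤ 4).trans h₂))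

/-- Diagonals give spectral floors: if `t^{⊠N} ≥ ⟨r⟩` with `q^N ≤ r 2^{εN}` cofinally for every `ε > 0`,
then `q ≤ F(t)` at every universal spectral point (apply `F`, take `N`-th roots, let `ε → 0⁺`). -/
theorem le_map_of_diagonals {ι κ μ : Type} [Fintype ι] [Fintype κ] [Fintype μ]
    (t : ι → κ → μ → ℂ) {q : ℝ}
    (hD : ∀ ε : ℝ, 0 < ε → ∀ N₀ : ℕ, ∃ N : ℕ, N₀ ≤ N ∧ ∃ r : ℕ,
      TensorRestrictsTo (kroneckerPow t N) (unitTensor ℂ r) ∧ q ^ N ≤ (r : ℝ) * (2 : ℝ) ^ (ε * N))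
    (hF : IsUniversalSpectralPoint ℂ F) : q ≤ F t := by
  have hk0 : 0 ≤ F t := hF.nonneg _
  have key : ∀ ε : ℝ, 0 < ε → ε < 1 → q ≤ (2 : ℝ) ^ ε * F t := by
    intro ε hε hε1
    obtain ⟨N, hN, r, hres, hr⟩ := hD ε hε 1
    have hN0 : N ≠ 0 := by omega
    have h := hF.mono _ _ hres
    simp only [hF.map_unitTensor, hF.map_kroneckerPow] at h
    have e2 : (2 : ℝ) ^ (ε * N) = ((2 : ℝ) ^ ε) ^ N := Real.rpow_mul_natCast (by norm_num) _ _
    rw [e2] at hr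
    have hpow : q ^ N ≤ ((2 : ℝ) ^ ε * F t) ^ N := by
      calc q ^ N ≤ (r : ℝ) * ((2 : ℝ) ^ ε) ^ N := hr
        _ ≤ F t ^ N * ((2 : ℝ) ^ ε) ^ N := mul_le_mul_of_nonneg_right h (by positivity)
        _ = ((2 : ℝ) ^ ε * F t) ^ N := by rw [mul_pow]; ring
    exact le_of_pow_le_pow_left₀ hN0 (by positivity) hpow
  have hlim : Tendsto (fun ε : ℝ => (2 : ℝ) ^ ε * F t) (𝓝[>] 0) (𝓝 ((2 : ℝ) ^ (0 : ℝ) * F t)) := by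
    have hc : ContinuousAt (fun x : ℝ => (2 : ℝ) ^ x) 0 := Real.continuousAt_const_rpow (by norm_num)
    have ht : Tendsto (fun x : ℝ => (2 : ℝ) ^ x) (𝓝[>] 0) (𝓝 ((2 : ℝ) ^ (0 : ℝ))) :=
      hc.tendsto.mono_left nhdsWithin_le_nhds
    exact ht.mul_const _
  rw [Real.rpow_zero, one_mul] at hlim
  refine ge_of_tendsto hlim ?_
  filter_upwards [Ioo_mem_nhdsGT (zero_lt_one' ℝ)] with ε hε using key ε hε.1 hε.2

/-- **`BlockDiagonal ⟹ BlockSubrankFull`**. -/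
theorem blockSubrankFull_of_diagonal (hD : BlockDiagonal) : BlockSubrankFull := by
  intro F hF
  refine ⟨le_map_of_diagonals coupling₁ ?_ hF, le_map_of_diagonals coupling₂ ?_ hF,
    le_map_of_diagonals coupling₃ ?_ hF⟩
  · intro ε hε N₀
    obtain ⟨N, hN, r, ⟨h₁, -, -⟩, hr⟩ := hD ε hε N₀
    exact ⟨N, hN, r, h₁, hr⟩
  · intro ε hε N₀
    obtain ⟨N, hN, r, ⟨-, h₂, -⟩, hr⟩ := hD ε hε N₀
    exact ⟨N, hN, r, h₂, hr⟩
  · intro ε hε N₀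
    obtain ⟨N, hN, r, ⟨-, -, h₃⟩, hr⟩ := hD ε hε N₀
    exact ⟨N, hN, r, h₃, hr⟩

/-- **`BlockSubrankFull → BlockTangency → BlockIsMM`**: strict above `τ = 2`, and at `τ_F ≤ 2` the floor
`F⟨2,2,2⟩ ≤ 4 ≤ F(C_k)` does it. -/
theorem blockIsMM_of_blockTangency (hQ : BlockSubrankFull) (hA : BlockTangency) : BlockIsMM := by
  intro F hF
  by_cases hτ : 2 < Real.logb 2 (F (matMulTensor ℂ 2 2 2))
  · obtain ⟨h₁, h₂, h₃⟩ := hA F hF hτ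
    exact ⟨h₁.le, h₂.le, h₃.le⟩
  · push Not at hτ
    have h4 := map_matMulTensor_le_four_of_matExp_le_two hF hτ
    obtain ⟨h₁, h₂, h₃⟩ := hQ F hF
    exact ⟨h4.trans h₁, h4.trans h₂, h4.trans h₃⟩

/-- **The refined block cut**: given full block subrank, `S ⟺ BlockIsMM ∧ CouplingMergeOptimal` — the
attacked piece is the pure asymptotic comparison `⟨2,2,2⟩ ≲ C_k` (three `4 × 4 × 4` tensors), the residual
is the coupling residual of g16. -/
theorem summit_iff_blockIsMM (hQ : BlockSubrankFull) :
    _root_.MatrixMultiplication ↔ BlockIsMM ∧ CouplingMergeOptimal :=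
  ⟨fun h => ⟨blockIsMM_of_summit hQ h, couplingMergeOptimal_of_summit h⟩,
    fun h => summit_of_coupling (couplingTangency_of_couplingIsMM (couplingIsMM_of_blockIsMM h.1)) h.2⟩

/-- `BlockIsMM → CouplingMergeOptimal → S` (no subrank hypothesis needed in this direction). -/
theorem summit_of_blockIsMM (h : BlockIsMM) (hR : CouplingMergeOptimal) : _root_.MatrixMultiplication :=
  summit_of_coupling (couplingTangency_of_couplingIsMM (couplingIsMM_of_blockIsMM h)) hR

/-- Through the squared laser floor the block leaf reaches the cut of record:
`SquaredLaserPacking → BlockIsMM → LaserTangency`. -/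
theorem laserTangency_of_blockIsMM (hP : SquaredLaserPacking) (h : BlockIsMM) :
    Theses.OutsiderSandwich.LaserTangency :=
  laserTangency_of_couplingIsMM hP (couplingIsMM_of_blockIsMM h)

/-! ## 5. The door: the residual side is discharged by ω-free upper bounds on the block -/

/-- **`BlockBelowMM ⟹ BlockMergeOptimal`**: at an ω-attaining point (Strassen duality, attained),
`F(C₁) ≤ F⟨2,2,2⟩`. -/
theorem blockMergeOptimal_of_blockBelowMM (h : BlockBelowMM) : BlockMergeOptimal := by
  obtain ⟨G, hG, hGτ⟩ := exists_top_point
  exact ⟨G, hG, hGτ, Or.inl (h G hG)⟩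

/-- **`BlockRankLeFour ⟹ BlockMergeOptimal`**: at an ω-attaining point `F(C₁) ≤ R̃(C₁) ≤ 4 ≤ F⟨2,2,2⟩`. -/
theorem blockMergeOptimal_of_blockRankLeFour (h : BlockRankLeFour) : BlockMergeOptimal := by
  obtain ⟨G, hG, hGτ⟩ := exists_top_point
  refine ⟨G, hG, hGτ, Or.inl ?_⟩
  exact (((strassen_duality_asymptoticRank_holds ℂ coupling₁).1 G hG).trans h.1).trans
    (four_le_map_matMulTensor_two hG)

/-- **`BlockRankLeFour ⟹ CouplingMergeOptimal`**: `F(C) = ∏ F(C_k) ≤ 64 ≤ 4 F⟨2,2,2⟩²`. -/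
theorem couplingMergeOptimal_of_blockRankLeFour (h : BlockRankLeFour) : CouplingMergeOptimal := by
  obtain ⟨G, hG, hGτ⟩ := exists_top_point
  refine ⟨G, hG, hGτ, ?_⟩
  have h₁ := ((strassen_duality_asymptoticRank_holds ℂ coupling₁).1 G hG).trans h.1
  have h₂ := ((strassen_duality_asymptoticRank_holds ℂ coupling₂).1 G hG).trans h.2.1
  have h₃ := ((strassen_duality_asymptoticRank_holds ℂ coupling₃).1 G hG).trans h.2.2
  have h4 := four_le_map_matMulTensor_two hG
  rw [map_couplingTensor hG]
  calc G coupling₁ * G coupling₂ * G coupling₃ ≤ 4 * 4 * 4 :=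
        mul_le_mul (mul_le_mul h₁ h₂ (hG.nonneg _) (by norm_num)) h₃ (hG.nonneg _) (by norm_num)
    _ = 4 * 4 ^ 2 := by norm_num
    _ ≤ 4 * G (matMulTensor ℂ 2 2 2) ^ 2 := by gcongr

/-- **The door.** `CouplingBenchmark → BlockRankLeFour → S`: at an ω-attaining point `4·(2^ω)² =
4F⟨2,2,2⟩² ≤ F(C) ≤ R̃(C₁)R̃(C₂)R̃(C₃) ≤ 64`, so `2^ω ≤ 4`.  Contrapositively (lens 4): if `ω > 2`, one of the
explicit `4 × 4 × 4` free tight `C_k` is a counterexample to Strassen's asymptotic rank conjecture. -/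
theorem summit_of_blockRankLeFour (hB : CouplingBenchmark) (h : BlockRankLeFour) :
    _root_.MatrixMultiplication := by
  obtain ⟨G, hG, hGτ⟩ := exists_top_point
  have h₁ := ((strassen_duality_asymptoticRank_holds ℂ coupling₁).1 G hG).trans h.1
  have h₂ := ((strassen_duality_asymptoticRank_holds ℂ coupling₂).1 G hG).trans h.2.1
  have h₃ := ((strassen_duality_asymptoticRank_holds ℂ coupling₃).1 G hG).trans h.2.2
  have h64 : G couplingTensor ≤ 64 := by
    rw [map_couplingTensor hG]
    calc G coupling₁ * G coupling₂ * G coupling₃ ≤ 4 * 4 * 4 :=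
          mul_le_mul (mul_le_mul h₁ h₂ (hG.nonneg _) (by norm_num)) h₃ (hG.nonneg _) (by norm_num)
      _ = 64 := by norm_num
  have hsq : G (matMulTensor ℂ 2 2 2) ^ 2 ≤ 4 ^ 2 := by
    have := hB G hG
    nlinarith
  have h4 : G (matMulTensor ℂ 2 2 2) ≤ 4 := by
    exact (pow_le_pow_iff_left₀ (hG.nonneg _) (by norm_num) two_ne_zero).1 hsq
  exact summit_of_top_le_four hG hGτ h4

end Summit.MatrixMultiplication.MatrixMultiplication.Theorems.OutsiderSandwichBlock
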